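import Literature.Computability.AlgebraicComplexity.PIProof
import HarnessLib

/-!
# Node values of a Hrubeš–Tzameret straight-line circuit

Companion of `Literature.Computability.AlgebraicComplexity.PIProof` (the circuits `PICircuit 𝔽 X`
of Hrubeš–Tzameret's system `P_c(𝔽)`, HT §1.1: a list of nodes `var x | const c | add i j |
mul i j` in topological order, children referenced by absolute position, a reference that does
not point to an EARLIER node being junk that unfolds to the leaf `0`).  `PIProof.lean` gives the
semantics through the UNFOLDING `C• : PIFormula` (`PICircuit.unfold`, `PICircuit.eval`); to
translate such a circuit gate by gate into another circuit model (the Dawar–Wilsenach labelled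
DAGs of `SymmetricArithCircuit.lean`, see `OrbitAveragingCircuit.lean`) one needs the value of
EVERY node and its recursion along the node list, which is what this file provides:

* `PICircuit.nodeAt C p` — the `p`-th node (output last; junk `const 0` beyond),
  `Node.left/right` — the child references, `Node.constOf`;
* `PICircuit.valueAt C p` — the polynomial computed at node `p` (the evaluation of the `p`-th
  entry of `unfoldList [] C.nodes`), `PICircuit.childValue C p i` — the value of the reference
  `i` seen from node `p` (`valueAt i` if `i < p`, else `0`);
* `PICircuit.valueAt_eq` — **the value recursion**: for `p < |C|`, `valueAt p` is `X x`, `C c`,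
  `childValue p i + childValue p j` or `childValue p i * childValue p j` according to the node;
  `PICircuit.valueAt_size_sub_one` — the last value is `Ĉ = C.eval`;
* `PICircuit.constSet C u` — the constants occurring in `C` together with `0` and one further
  constant `u`, with `|constSet| ≤ |C| + 2` (the constant input gates a translation needs).

Everything is proved; folklore bookkeeping over HT §1.1 / Remark 1.3.
-/

noncomputable section

namespace Literature.Computability.AlgebraicComplexity

open MvPolynomial

universe u v

namespace PICircuit

variable {𝔽 : Type u} {X : Type v}

section NodeAt

variable [Zero 𝔽]

/-- The `p`-th node of a circuit (all nodes in order, output last; junk `const 0` beyond). [folklore] -/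
def nodeAt (C : PICircuit 𝔽 X) (p : ℕ) : Node 𝔽 X := C.nodes.getD p (.const 0)

/-- The `p`-th node of a circuit is a member of its node list. [folklore] -/
theorem nodeAt_mem (C : PICircuit 𝔽 X) {p : ℕ} (hp : p < C.size) : C.nodeAt p ∈ C.nodes := by
  unfold nodeAt
  rw [List.getD_eq_getElem _ _ (by simpa using hp)]
  exact List.getElem_mem _

/-- Beyond the last node, `nodeAt` is the junk leaf `0`. [folklore] -/
theorem nodeAt_of_le (C : PICircuit 𝔽 X) {p : ℕ} (hp : C.size ≤ p) : C.nodeAt p = .const 0 := by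
  unfold nodeAt
  exact List.getD_eq_default _ _ (by simpa using hp)

end NodeAt

/-- Left child reference of a node (`0` for leaves). [folklore] -/
def Node.left : Node 𝔽 X → ℕ
  | .var _ => 0
  | .const _ => 0
  | .add i _ => i
  | .mul i _ => i

/-- Right child reference of a node (`0` for leaves). [folklore] -/
def Node.right : Node 𝔽 X → ℕ
  | .var _ => 0
  | .const _ => 0
  | .add _ j => j
  | .mul _ j => j

/-- The constant labelling a node, if it is a constant leaf. [folklore] -/
def Node.constOf : Node 𝔽 X → Option 𝔽
  | .const c => some c
  | _ => none

section Values

variable [CommSemiring 𝔽]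

/-- The polynomial computed at the `p`-th node of a circuit (junk `0` beyond the last node).
[folklore] -/
def valueAt (C : PICircuit 𝔽 X) (p : ℕ) : MvPolynomial X 𝔽 :=
  ((unfoldList [] C.nodes).getD p (.const 0)).eval

/-- The value of a (possibly junk) child reference `i` of the `p`-th node: the value of node `i`
if `i < p`, else `0` (HT's junk convention). [folklore] -/
def childValue (C : PICircuit 𝔽 X) (p i : ℕ) : MvPolynomial X 𝔽 :=
  if i < p then C.valueAt i else 0

/-- The semantics of a node given the values of its two (possibly junk) children. [folklore] -/
def Node.evalWith (l r : MvPolynomial X 𝔽) : Node 𝔽 X → MvPolynomial X 𝔽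
  | .var x => MvPolynomial.X x
  | .const c => MvPolynomial.C c
  | .add _ _ => l + r
  | .mul _ _ => l * r

/-- The unfoldings of the first `p` nodes are the first `p` unfoldings. [folklore] -/
theorem getD_unfoldList_take (C : PICircuit 𝔽 X) (p i : ℕ) :
    (unfoldList [] (C.nodes.take p)).getD i (.const 0) =
      if i < p then (unfoldList [] C.nodes).getD i (.const 0) else .const 0 := by
  have hlen : (unfoldList [] (C.nodes.take p)).length = min p C.nodes.length := by
    simp only [length_unfoldList, List.length_nil, List.length_take, zero_add]
  split_ifs with hi
  · rcases lt_or_ge i C.nodes.length with hil | hil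
    · have hi' : i < (unfoldList [] (C.nodes.take p)).length := by
        rw [hlen]; exact lt_min hi hil
      conv_rhs => rw [← List.take_append_drop p C.nodes, unfoldList_append]
      rw [getD_unfoldList_of_lt _ _ hi']
    · rw [List.getD_eq_default, List.getD_eq_default]
      · simpa using hil
      · rw [hlen]; exact min_le_of_right_le hil
  · rw [List.getD_eq_default]
    rw [hlen]; exact min_le_of_left_le (not_lt.1 hi)

/-- The unfolding of the `p`-th node in terms of the earlier unfoldings. [folklore] -/
theorem getD_unfoldList_nodes_eq (C : PICircuit 𝔽 X) {p : ℕ} (hp : p < C.size) :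
    (unfoldList [] C.nodes).getD p (.const 0) =
      (C.nodeAt p).unfold (unfoldList [] (C.nodes.take p)) := by
  have hlen : p < C.nodes.length := by simpa using hp
  have hlt : (unfoldList [] (C.nodes.take p)).length = p := by
    simp only [length_unfoldList, List.length_nil, List.length_take, zero_add]
    exact min_eq_left hlen.le
  conv_lhs => rw [← List.take_append_drop p C.nodes, List.drop_eq_getElem_cons hlen,
    unfoldList_append, unfoldList_cons]
  rw [getD_unfoldList_of_lt _ _ (by simp [hlt])]
  rw [List.getD_append_right _ _ _ _ (by simp [hlt])]
  simp only [hlt, Nat.sub_self, List.getD_cons_zero, nodeAt]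
  rw [List.getD_eq_getElem _ _ hlen]

/-- **Value recursion.** For `p < |C|`, the value of node `p` is its label's operation applied to
the values of its child references (`0` for junk references). [folklore] -/
theorem valueAt_eq (C : PICircuit 𝔽 X) {p : ℕ} (hp : p < C.size) :
    C.valueAt p = (C.nodeAt p).evalWith (C.childValue p (C.nodeAt p).left)
      (C.childValue p (C.nodeAt p).right) := by
  unfold valueAt
  rw [C.getD_unfoldList_nodes_eq hp]
  cases h : C.nodeAt p with
  | var x => rfl
  | const c => rfl
  | add i j =>
    simp only [Node.unfold, PIFormula.eval_add, getD_unfoldList_take, Node.evalWith, Node.left,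
      Node.right, childValue, valueAt]
    congr 1 <;> split_ifs <;> simp
  | mul i j =>
    simp only [Node.unfold, PIFormula.eval_mul, getD_unfoldList_take, Node.evalWith, Node.left,
      Node.right, childValue, valueAt]
    congr 1 <;> split_ifs <;> simp

/-- The value of the last node is the polynomial computed by the circuit. [folklore] -/
theorem valueAt_size_sub_one (C : PICircuit 𝔽 X) : C.valueAt (C.size - 1) = C.eval := by
  unfold valueAt PICircuit.eval
  have : C.size - 1 = C.body.length := by simp [size]
  rw [this, getD_unfoldList_nodes]

end Values

section Consts

variable [Zero 𝔽] [DecidableEq 𝔽]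

/-- The constants of a circuit together with `0` and a further constant `u` (the set of constant
input gates of the orbit-averaging circuit). [folklore] -/
def constSet (C : PICircuit 𝔽 X) (u : 𝔽) : Finset 𝔽 :=
  insert 0 (insert u (C.nodes.filterMap Node.constOf).toFinset)

/-- `0 ∈ constSet`. [folklore] -/
theorem zero_mem_constSet (C : PICircuit 𝔽 X) (u : 𝔽) : (0 : 𝔽) ∈ C.constSet u :=
  Finset.mem_insert_self _ _

/-- `u ∈ constSet`. [folklore] -/
theorem mem_constSet_self (C : PICircuit 𝔽 X) (u : 𝔽) : u ∈ C.constSet u :=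
  Finset.mem_insert_of_mem (Finset.mem_insert_self _ _)

/-- Every constant leaf of the circuit is in `constSet`. [folklore] -/
theorem mem_constSet_of_nodeAt (C : PICircuit 𝔽 X) (u : 𝔽) {p : ℕ} {c : 𝔽}
    (h : C.nodeAt p = .const c) : c ∈ C.constSet u := by
  rcases lt_or_ge p C.size with hp | hp
  · refine Finset.mem_insert_of_mem (Finset.mem_insert_of_mem ?_)
    rw [List.mem_toFinset, List.mem_filterMap]
    exact ⟨_, C.nodeAt_mem hp, by rw [h]; rfl⟩
  · rw [C.nodeAt_of_le hp] at h
    cases h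
    exact C.zero_mem_constSet u

/-- `|constSet| ≤ |C| + 2`. [folklore] -/
theorem card_constSet_le (C : PICircuit 𝔽 X) (u : 𝔽) : (C.constSet u).card ≤ C.size + 2 := by
  unfold constSet
  refine (Finset.card_insert_le _ _).trans ?_
  refine (Nat.succ_le_succ (Finset.card_insert_le _ _)).trans ?_
  have h1 := List.toFinset_card_le (C.nodes.filterMap Node.constOf)
  have h2 := List.length_filterMap_le Node.constOf C.nodes
  rw [length_nodes] at h2
  omega

end Consts

end PICircuit

end Literature.Computability.AlgebraicComplexity
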